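import Mathlib
import Summits.Ventures.PercRepro2.SwOutJunctionH1Key
import Summits.Ventures.PercRepro2.SwOutJunctionH1GTypedOrbits

/-!
# THE (H1) SINGLE JUNCTION ON THE GENERAL DOUBLY TYPED SIDE: the theorem (blind cell PercRepro2,
night-4 g33, 2026-08-28; proofs/NIGHT4-G33.md §4)

g14's Theorem A (`rigidOK_of_junctionH1`) for g7's general doubly typed row: the side `gOutSide
ends l h 𝓤 𝓓 𝓓″ X 𝓤′ U ξ` of every class of an (H1) single-junction region is partitioned by
g14's key (`keyOf`) into coarse orbits, core cubes and shadow blocks (`blockOf`); every side point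
lies in the block of its key (`mem_blockOf_keyOf_g`), every side point of that block has the same
key (`keyOf_eq_of_mem_blockOf_g`), and every block satisfies the rigid counting inequality on
`gTypedQ` (`card_blockOf_le_g`; the cube inequalities of SwOutJunctionH1GTypedCubes); the block
decomposition (`rigidOK_g_of_blocks`) assembles them: **`rigidOK_g_of_junctionH1`**.  On the
graph: **`gTypedSwAll_of_junctionH1`** — the general doubly typed row on every graph with one (H1)
junction `u` in `{l}ᶜ` whose other vertices are exempt (forced into `C_R(l)` by `𝓤`), joined to
`l`, or isolated, the vertices of `X` other than `l` isolated.  The exemption «forced out of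
`C_R(h)` by `𝓓″`» is NOT carried (the two sides of the extended hull need not be disjoint for it;
NIGHT4-G33.md §1), although the statement is census-true with it (0 / 50,869 at n ≤ 6).
-/

namespace Summit.Ventures.PercRepro2

namespace LocRows

open Hull

variable {V : Type*} {E : Type*} [Fintype E] [DecidableEq E]

open scoped Classical

variable {ends : E → Sym2 V} {U : Set V} {ξ : Config E} {l h u : V}
  {𝓤 𝓓 𝓓'' : Set (Set V)} {X : Set V} {𝓤' : Set (Set V)} {F : V → Prop}

section Blocks

/-- **The rigid inequality from a block decomposition, general doubly typed side.** -/
theorem rigidOK_g_of_blocks {K : Type*} (key : Config E → K) (block : K → Finset (Config E))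
    (hmem : ∀ ζ ∈ gOutSide ends l h 𝓤 𝓓 𝓓'' X 𝓤' U ξ, ζ ∈ block (key ζ))
    (hblock : ∀ ζ ∈ gOutSide ends l h 𝓤 𝓓 𝓓'' X 𝓤' U ξ, ∀ ζ' ∈ block (key ζ),
      ζ' ∈ gTypedQ ends l h 𝓤 𝓓 𝓓'' X 𝓤' →
        ζ' ∈ gOutSide ends l h 𝓤 𝓓 𝓓'' X 𝓤' U ξ ∧ key ζ' = key ζ)
    (hineq : ∀ ζ ∈ gOutSide ends l h 𝓤 𝓓 𝓓'' X 𝓤' U ξ, ∀ 𝓔 : Set (Set E), IsUpperSet 𝓔 →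
      ((block (key ζ)).filter fun ζ' =>
          ζ' ∈ gTypedQ ends l h 𝓤 𝓓 𝓓'' X 𝓤' ∧ redEdges ends ζ' h ∈ 𝓔).card ≤
        ((block (key ζ)).filter fun ζ' =>
          ζ' ∈ gTypedQ ends l h 𝓤 𝓓 𝓓'' X 𝓤' ∧ blueEdges ends ζ' h ∈ 𝓔).card)
    {𝓔 : Set (Set E)} (h𝓔 : IsUpperSet 𝓔) :
    ((gOutSide ends l h 𝓤 𝓓 𝓓'' X 𝓤' U ξ).filter fun ζ => redEdges ends ζ h ∈ 𝓔).card ≤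
      ((gOutSide ends l h 𝓤 𝓓 𝓓'' X 𝓤' U ξ).filter fun ζ => blueEdges ends ζ h ∈ 𝓔).card := by
  set C := gOutSide ends l h 𝓤 𝓓 𝓓'' X 𝓤' U ξ with hC
  let S₀ : Finset K := C.image key
  have hmapR : ∀ ζ ∈ C.filter fun ζ => redEdges ends ζ h ∈ 𝓔, key ζ ∈ S₀ :=
    fun ζ hζ => Finset.mem_image_of_mem key (Finset.mem_filter.1 hζ).1
  have hmapB : ∀ ζ ∈ C.filter fun ζ => blueEdges ends ζ h ∈ 𝓔, key ζ ∈ S₀ :=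
    fun ζ hζ => Finset.mem_image_of_mem key (Finset.mem_filter.1 hζ).1
  rw [Finset.card_eq_sum_card_fiberwise hmapR, Finset.card_eq_sum_card_fiberwise hmapB]
  refine Finset.sum_le_sum fun k hk => ?_
  obtain ⟨ζ₀, hζ₀, rfl⟩ := Finset.mem_image.1 hk
  have hfib : ∀ P : Config E → Prop,
      (C.filter fun ζ => P ζ).filter (fun ζ => key ζ = key ζ₀) =
        (block (key ζ₀)).filter fun ζ' => ζ' ∈ gTypedQ ends l h 𝓤 𝓓 𝓓'' X 𝓤' ∧ P ζ' := by
    intro P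
    ext ζ'
    simp only [Finset.mem_filter]
    constructor
    · rintro ⟨⟨hζ', hP⟩, hkey⟩
      have := hmem ζ' hζ'
      rw [hkey] at this
      exact ⟨this, (mem_gOutSide.1 hζ').1, hP⟩
    · rintro ⟨hb, hQ, hP⟩
      obtain ⟨hcl, hkey⟩ := hblock ζ₀ hζ₀ ζ' hb hQ
      exact ⟨⟨hcl, hP⟩, hkey⟩
  rw [hfib, hfib]
  exact hineq ζ₀ hζ₀ 𝓔 h𝓔

end Blocks

section Main

variable (h𝓤 : IsUpperSet 𝓤) (h𝓓 : IsLowerSet 𝓓) (h𝓓'' : IsLowerSet 𝓓'') (h𝓤' : IsUpperSet 𝓤')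
  (hl : l ∉ U) (hhu : h ≠ u) (hloop_h : ∀ e, ends e ≠ s(h, h))
  (hloop_u : ∀ e, ends e ≠ s(u, u)) (hnadj : ∀ e, ends e ≠ s(h, u))
  (hF : ∀ x, F x → ∀ S ∈ 𝓤, x ∈ S)
  (hout : ∀ x ∈ U, x ≠ h → x ≠ u →
    F x ∨ x ∈ X ∨ (∃ e y, ends e = s(x, y) ∧ y ∉ U) ∨ (∀ e, x ∉ ends e))
  (hH1 : H1 ends U h u)
  (hhX : h ∉ X) (huX : u ∉ X) (hX : ∀ x ∈ X, x ∈ U → ∀ e, x ∈ ends e → ends e = s(x, x))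
include hl hhu hloop_h hloop_u hnadj hF hout hhX huX hX hH1

omit hloop_h hloop_u hnadj hH1 hhX huX in
/-- Every side point lies in the block of its key. -/
theorem mem_blockOf_keyOf_g {ζ : Config E} (hζ : ζ ∈ gOutSide ends l h 𝓤 𝓓 𝓓'' X 𝓤' U ξ) :
    ζ ∈ blockOf ends h u (keyOf ends U ξ h u ζ) := by
  by_cases hu : u ∉ hull ends ζ h
  · rw [keyOf_of_out hu]
    obtain ⟨ω, hω⟩ := exists_orbitReal_eq (coreFree_of_u_notMem_hull_g hF hout hζ hu) rfl
    simp only [blockOf, orbit, Finset.mem_image, Finset.mem_univ, true_and]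
    exact ⟨ω, hω⟩
  rw [not_not] at hu
  by_cases hk : hull ends ζ u ⊆ U
  · rw [keyOf_of_coreKind hu hk]
    exact (mem_coreCube).2 ⟨omegaOf ends h u ζ, coreReal_coreBaseOf_g hl hhu hF hout hX hζ ⟨hu, hk⟩⟩
  by_cases hs : ShadowKind ends U ξ h u ζ
  · rw [keyOf_of_shadowKind hu hk hs]
    exact hs.2
  · rw [keyOf_of_plain hu hk hs]
    have hc : CoreFree ends ζ h := coreFree_of_escaping_g hF hout hζ hk
    obtain ⟨ω, hω⟩ := exists_orbitReal_eq (ζ₀ := allRed ends ζ h) hc rfl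
    simp only [blockOf, orbit, Finset.mem_image, Finset.mem_univ, true_and]
    exact ⟨ω, hω⟩

include h𝓤 h𝓓 h𝓓'' h𝓤' in
/-- Every side point of the block of a side point lies in the side with the same key. -/
theorem keyOf_eq_of_mem_blockOf_g {ζ : Config E} (hζ : ζ ∈ gOutSide ends l h 𝓤 𝓓 𝓓'' X 𝓤' U ξ)
    {ζ' : Config E} (hζ' : ζ' ∈ blockOf ends h u (keyOf ends U ξ h u ζ))
    (hQ : ζ' ∈ gTypedQ ends l h 𝓤 𝓓 𝓓'' X 𝓤') :
    ζ' ∈ gOutSide ends l h 𝓤 𝓓 𝓓'' X 𝓤' U ξ ∧ keyOf ends U ξ h u ζ' = keyOf ends U ξ h u ζ := by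
  by_cases hu : u ∉ hull ends ζ h
  · rw [keyOf_of_out hu] at hζ' ⊢
    obtain ⟨h1, h2, h3⟩ :=
      (orbitKind_block_g h𝓤 h𝓓 h𝓓'' h𝓤' hl hloop_h hF hout hζ hu).2.1 ζ' hζ' hQ
    exact ⟨h1, by rw [keyOf_of_out h2, h3]⟩
  rw [not_not] at hu
  by_cases hk : hull ends ζ u ⊆ U
  · rw [keyOf_of_coreKind hu hk] at hζ' ⊢
    have hb : CoreBase ends (coreBaseOf ends ζ h u) h u (extHull ends ζ h u)
        (armsFun (armsC ends h u ζ)) (pureFun ends h (armsC ends h u ζ)) :=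
      coreBase_of_coreKind_g hl hhu hloop_h hloop_u hnadj hF hout hX hH1 hζ ⟨hu, hk⟩
    have hHU := extHull_subset_of_coreKind_g hζ ⟨hu, hk⟩
    obtain ⟨ω, rfl⟩ := (mem_coreCube).1 hζ'
    have hbcl := coreBaseOf_mem_outClass (mem_gOutSide.1 hζ).2 ⟨hu, hk⟩ hb
    refine ⟨mem_gOutSide.2 ⟨hQ, hb.coreReal_mem_outClass hHU hbcl ω⟩, ?_⟩
    rw [keyOf_of_coreKind (hb.u_mem_hull_coreReal ω) ((hb.hull_u_coreReal_subset ω).trans hHU),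
      hb.coreBaseOf_coreReal, armsC_eq_of_extHull_eq (hb.extHull_coreReal ω)]
  by_cases hs : ShadowKind ends U ξ h u ζ
  · rw [keyOf_of_shadowKind hu hk hs] at hζ' ⊢
    obtain ⟨h1, h2, h3, h4, h5, h6, h7⟩ := shadowKind_of_mem_shadowBlock_g hl hF hout hhX huX hX hs.1 hζ' hQ
    exact ⟨h5, by rw [keyOf_of_shadowKind h6 h7 h4, h1, h2, h3]⟩
  · rw [keyOf_of_plain hu hk hs] at hζ' ⊢
    obtain ⟨h1, h2, h3, h4⟩ :=
      mem_orbit_plain_g hl hhu hloop_h hloop_u hnadj hF hout hhX huX hX hH1 hζ hu hk hs hζ' hQ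
    refine ⟨h1, ?_⟩
    rw [keyOf_of_plain h2 h3 h4]
    -- the all-red orientation is constant along the orbit
    have hc : CoreFree ends ζ h := coreFree_of_escaping_g hF hout hζ hk
    simp only [blockOf, orbit, Finset.mem_image, Finset.mem_univ, true_and] at hζ'
    obtain ⟨ω, rfl⟩ := hζ'
    rw [allRed_orbitReal (coreFree_allRed hc), allRed_idem hc]

include h𝓤 h𝓓 h𝓓'' h𝓤' in
/-- Every block of a side point satisfies the rigid inequality on `gTypedQ`. -/
theorem card_blockOf_le_g {ζ : Config E} (hζ : ζ ∈ gOutSide ends l h 𝓤 𝓓 𝓓'' X 𝓤' U ξ)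
    {𝓔 : Set (Set E)} (h𝓔 : IsUpperSet 𝓔) :
    ((blockOf ends h u (keyOf ends U ξ h u ζ)).filter fun ζ' =>
        ζ' ∈ gTypedQ ends l h 𝓤 𝓓 𝓓'' X 𝓤' ∧ redEdges ends ζ' h ∈ 𝓔).card ≤
      ((blockOf ends h u (keyOf ends U ξ h u ζ)).filter fun ζ' =>
        ζ' ∈ gTypedQ ends l h 𝓤 𝓓 𝓓'' X 𝓤' ∧ blueEdges ends ζ' h ∈ 𝓔).card := by
  by_cases hu : u ∉ hull ends ζ h
  · rw [keyOf_of_out hu]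
    exact (orbitKind_block_g h𝓤 h𝓓 h𝓓'' h𝓤' hl hloop_h hF hout hζ hu).2.2 𝓔 h𝓔
  rw [not_not] at hu
  by_cases hk : hull ends ζ u ⊆ U
  · rw [keyOf_of_coreKind hu hk]
    have hb : CoreBase ends (coreBaseOf ends ζ h u) h u (extHull ends ζ h u)
        (armsFun (armsC ends h u ζ)) (pureFun ends h (armsC ends h u ζ)) :=
      coreBase_of_coreKind_g hl hhu hloop_h hloop_u hnadj hF hout hX hH1 hζ ⟨hu, hk⟩
    have hHU := extHull_subset_of_coreKind_g hζ ⟨hu, hk⟩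
    exact hb.card_coreCube_le_g h𝓤 h𝓓 h𝓓'' h𝓤' hHU hl
      (fun x hx => notMem_extHull_of_mem_X hhX huX hX hHU hx) h𝓔
  by_cases hs : ShadowKind ends U ξ h u ζ
  · rw [keyOf_of_shadowKind hu hk hs]
    exact shadowBlock_card_le_g h𝓤 h𝓓 h𝓓'' h𝓤' hl hs.1.hHU hs.1.hb hs.1.huR hs.1.huB
      (fun x hx => notMem_extHull_of_mem_X hhX huX hX hs.1.hHU hx) h𝓔
  · rw [keyOf_of_plain hu hk hs]
    have hc : CoreFree ends ζ h := coreFree_of_escaping_g hF hout hζ hk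
    exact card_orbit_le_g (coreFree_allRed hc) hloop_h h𝓤 h𝓓 h𝓓'' h𝓤'
      (allRed_mem_outClass (mem_gOutSide.1 hζ).2 hc) hl h𝓔

include h𝓤 h𝓓 h𝓓'' h𝓤' in
/-- **THE (H1) SINGLE JUNCTION ON THE GENERAL DOUBLY TYPED SIDE** (g14's Theorem A for g7's row):
the rigid counting inequality on `gTypedQ` over every class of an (H1) single-junction region
`U ∋ h`, `l ∉ U` — `u ∈ U` with no loop, not adjacent to `h`, (H1) in `U`; every other vertex of
`U ∖ {h}` exempt (forced into `C_R(l)` by `𝓤`), with an outside edge, or with no edge; the vertices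
of `X` inside `U` isolated, `h, u ∉ X`; no loop at `h`. -/
theorem rigidOK_g_of_junctionH1 {𝓔 : Set (Set E)} (h𝓔 : IsUpperSet 𝓔) :
    ((gOutSide ends l h 𝓤 𝓓 𝓓'' X 𝓤' U ξ).filter fun ζ => redEdges ends ζ h ∈ 𝓔).card ≤
      ((gOutSide ends l h 𝓤 𝓓 𝓓'' X 𝓤' U ξ).filter fun ζ => blueEdges ends ζ h ∈ 𝓔).card :=
  rigidOK_g_of_blocks (keyOf ends U ξ h u) (blockOf ends h u)
    (fun _ hζ => mem_blockOf_keyOf_g hl hhu hF hout hX hζ)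
    (fun _ hζ _ hζ' hQ =>
      keyOf_eq_of_mem_blockOf_g h𝓤 h𝓓 h𝓓'' h𝓤' hl hhu hloop_h hloop_u hnadj hF hout hH1 hhX huX hX hζ
        hζ' hQ)
    (fun _ hζ _ h𝓔' =>
      card_blockOf_le_g h𝓤 h𝓓 h𝓓'' h𝓤' hl hhu hloop_h hloop_u hnadj hF hout hH1 hhX huX hX hζ h𝓔')
    h𝓔

end Main

section Graph

/-- **The general doubly typed row on every graph with one (H1) junction**: `u ≠ l, h`, no loop at
`h` or `u`, `u` not adjacent to `h`, (H1) in `{l}ᶜ`; every other vertex exempt (forced into `C_R(l)`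
by the up-set `𝓤`), joined to `l`, or isolated; the vertices of `X` other than `l` isolated,
`h, u ∉ X`; `𝓤, 𝓤′` up-sets, `𝓓, 𝓓″` down-sets. -/
theorem gTypedSwAll_of_junctionH1 (hlh : l ≠ h) (hlu : l ≠ u) (hhu : h ≠ u)
    (hloop_h : ∀ e, ends e ≠ s(h, h)) (hloop_u : ∀ e, ends e ≠ s(u, u))
    (hnadj : ∀ e, ends e ≠ s(h, u)) (hH1 : H1 ends ({l}ᶜ) h u)
    (h𝓤 : IsUpperSet 𝓤) (h𝓓 : IsLowerSet 𝓓) (h𝓓'' : IsLowerSet 𝓓'') (h𝓤' : IsUpperSet 𝓤')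
    (hF : ∀ x, F x → ∀ S ∈ 𝓤, x ∈ S) (hhX : h ∉ X) (huX : u ∉ X)
    (hX : ∀ x ∈ X, x ≠ l → ∀ e, x ∈ ends e → ends e = s(x, x))
    (hout : ∀ x, x ≠ l → x ≠ h → x ≠ u →
      F x ∨ x ∈ X ∨ (∃ e, ends e = s(x, l)) ∨ (∀ e, x ∉ ends e)) :
    GTypedSwAll ends l h 𝓤 𝓓 𝓓'' X 𝓤' := by
  have _hlu := hlu
  refine exists_swAll_injection_of_card_le h _ (card_le_g_of_classes hlh fun ξ 𝓔 h𝓔 => ?_)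
  refine rigidOK_g_of_junctionH1 (ξ := ξ) (u := u) (F := F) h𝓤 h𝓓 h𝓓'' h𝓤' (by simp) hhu hloop_h
    hloop_u hnadj hF ?_ hH1 hhX huX ?_ h𝓔
  · intro x hx hxh hxu
    rcases hout x (by simpa using hx) hxh hxu with hf | hxX | ⟨e, he⟩ | hiso
    · exact Or.inl hf
    · exact Or.inr (Or.inl hxX)
    · exact Or.inr (Or.inr (Or.inl ⟨e, l, he, by simp⟩))
    · exact Or.inr (Or.inr (Or.inr hiso))
  · intro x hx hxU
    exact hX x hx (by simpa using hxU)

end Graph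

end LocRows

end Summit.Ventures.PercRepro2
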